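import Literature.AlgebraicGeometry.Hyperkaehler.MarkmanRationalHodgeIsometries
import Literature.AlgebraicGeometry.Hyperkaehler.K3HilbertSquareTypeCohomology
import Literature.AlgebraicGeometry.HodgeTheory.MotivatedClassesAssembly
import Literature.AlgebraicGeometry.HodgeTheory.HodgeConjecture
import HarnessLib

/-!
# Markman's LIFT of a rational Hodge isometry of `H²` to an algebraic, Mukai-isometric correspondence on TOTAL cohomology (`K3^{[n]}`-type, Compos. Math. 2024, Thm. 1.1 first part + Thm. 1.4) — 2 DEFINITIONS, 1 NAMED FACT, PROVED corollary «HC is a rational-Hodge-isometry invariant»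

Layer `Literature/AlgebraicGeometry/Hyperkaehler`.  Companion of `MarkmanRationalHodgeIsometries`
(which records only the LAST sentence of Markman's Thm. 1.1, "`f` is algebraic whenever `X` and `Y`
are projective", and lists the lift `f̃` under "What is NOT here"), typed at the cross-ladder
literature-typing seat littype-FH1-1 (home `run/shared/lean/pub/hodge-nonav/`) for
`Summit.HodgeConjecture…Theses.MarkmanPartnerTransport`: the planner's memo ROUTE-P1D (§2 row HK12 =
rung R1a `HC_K3Sq2Type_isometryInvariant`, §3.1 R1⁺, definition request «NEW-FACT F-M̃ (Markman's
lift)») uses exactly this lift: an ALGEBRAIC correspondence on total cohomology with ALGEBRAIC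
inverse transports the Hodge conjecture between `X` and `Y` (`…hodgeConjectureFor_iff` below, PROVED
from the fact and the tree's multiplicativity fact `HodgeTheory.Voisin2003_cupProduct_algebraicClasses`).

## Source (READ at this seat; held text `paper:arxiv-2204.00516` = arXiv v2 = the published numbering)

E. Markman, *Rational Hodge isometries of hyper-Kähler varieties of `K3^{[n]}` type are algebraic*,
Compos. Math. 160 (2024) 1261–1303 [`Markman2024`; REFEREED; open access], §1.1, verbatim:

* (p. 1261–1262; arXiv p. 3) "Given a class `α` in the even cohomology `H^{ev}(X,ℚ)` of `X`, denote
  by `αᵢ` its graded summand in `H^{2i}(X,ℚ)`. Let `α^∨ ∈ H^{ev}(X,ℚ)` be the class satisfying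
  `(α^∨)ᵢ = (−1)ⁱ αᵢ`. The Mukai pairing on the even cohomology `H^{ev}(X,ℚ)` is defined by
  `(α,β) := ∫_X α^∨ ∪ β`. […] When `X` is of `K3^{[n]}`-type the odd cohomology vanishes […] We say
  that a homomorphism `f : H^*(X,ℚ)[2n] → H^*(Y,ℚ)[2n]` is degree reversing, if it maps `Hᵏ(X,ℚ)[2n]`
  to `H^{−k}(Y,ℚ)[2n]`, for all `k`. […] Let `X` and `Y` be IHSMs of `K3^{[n]}`-type and
  `f : H²(X,ℚ) → H²(Y,ℚ)` a Hodge isometry.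
  **Theorem 1.1.** There exists an analytic correspondence `f̃ : H^*(X,ℚ) → H^*(Y,ℚ)`, which is an
  isometry with respect to the Mukai pairings and satisfies one of the following:
  (1) `f̃` is degree preserving and it restricts to `H²(X,ℚ)` as `f`;
  (2) `f̃` is degree reversing and the composition `H^*(X,ℚ) —c₂(X)^{n−1}∪→ H^*(X,ℚ) —f̃→ H^*(Y,ℚ)`
  of `f̃` with cup product with `c₂(X)^{n−1}` restricts to `H²(X,ℚ)` as a non-zero rational multiple
  of `f`.
  In particular, `f` is algebraic whenever `X` and `Y` are projective."
* (p. 1264; arXiv p. 4) "Let `𝒢_an` be the subgroupoid of `𝒢` with the same objects. Morphisms of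
  `𝒢_an` are compositions of two types of rational isometries: (1) Parallel-transport operators
  `f : H^*(X,ℚ) → H^*(Y,ℚ)`, which are Hodge isometries. (2) Hodge isometries
  `[κ(𝒫)√td_{X×Y}]_* : H^*(X,ℚ) → H^*(Y,ℚ)` induced by classes […]. Morphisms in `𝒢_an` are induced
  by analytic correspondences."
* (p. 1264; arXiv p. 5) "**Theorem 1.4.** The functor `H̃₀ : 𝒢_an^{[n]} → ℋdg^{[n]}` is full. In
  particular, the analytic correspondence `f̃` of Theorem 1.1 can be chosen to be a morphism in
  `Hom_{𝒢_an^{[n]}}((X,ε),(Y,ε'))`."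
* (Abstract) "A cohomology class in their product `X×Y` is an analytic correspondence, if it belongs to
  the subring generated by Chern classes of coherent analytic sheaves. […] We furthermore lift `f` to
  an analytic correspondence `F` between their total rational cohomologies, which is a Hodge
  isometry with respect to the Mukai pairings, and which preserves the gradings up to sign. When `X`
  and `Y` are projective the correspondences `f` and `F` are algebraic."

So, for PROJECTIVE `X, Y`: `f̃ = [Z]_*` for an algebraic (mixed-degree) class `Z` on `Y × X`; being a
morphism of the groupOID `𝒢_an`, its inverse `f̃⁻¹ ∈ Hom_{𝒢_an}(Y, X)` is again "induced by an
analytic correspondence", hence (same GAGA/Chow step as Markman's "In particular") by an algebraic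
class `W` on `X × Y`; `f̃` is a Hodge isometry both ways and preserves the grading up to sign.

## Rendering (tree carriers) and design

* Total cohomology `H^*(X,ℚ) ⊗ ℂ`, degree-wise: the family of even-degree carriers
  `HodgeTheory.complexBetti X (2i)`, `0 ≤ i ≤ 2n` (`dim_ℂ X = 2n`; odd cohomology of `K3^{[n]}`-type
  vanishes, loc. cit.).  A degree-preserving `f̃` is a family `F i : H^{2i}(X(ℂ)) → H^{2i}(Y(ℂ))`; a
  degree-reversing one a family `G i : H^{2i}(X(ℂ)) → H^{2(2n−i)}(Y(ℂ))` (indexed by the SOURCE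
  degree, so that Hodge classes of codimension `i` are fed to `G i` without casts).
* "`f̃ = [Z]_*`, `Z` algebraic": on `H^{2i}` a degree-preserving `[Z]_*` is the action of the graded
  piece `Z_{2n} ∈ N^{2n}H^{4n}(Y × X)` (the other pieces land in other degrees, hence act by `0`) — ONE
  class for all `i`; a degree-reversing `[Z]_*` acts on `H^{2i}` through the piece
  `Z_{4n−2i} ∈ N^{4n−2i}H^{8n−4i}(Y × X)` — one class per `i`.  Actions are the tree's
  `HodgeTheory.corrAction μ` (`[γ]_* c = pr_{Y*}(pr_X^* c ∪ γ)`, `ComplexGysinCorrespondence`), for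
  EVERY orientation family `μ` with Poincaré duality, algebraicity as membership in the `ℂ`-span
  `HodgeTheory.algebraicClasses (Y ⊗ X) e` (different `μ` rescale `[γ]_*` by a unit, absorbed in the
  span; `corrAction_eq_smul_of_orientationFamily`) — symbol for symbol the convention of
  `Markman2024_rationalHodgeIsometry_algebraic_marked` and `Surfaces.Buskin2019_hodgeIsometry_algebraic`.
  The inverse is recorded as an algebraic LEFT inverse `[W]_* ∘ F i = id` together with the
  bijectivity of each `F i` (so `[W]_*` is the two-sided inverse).  That the off-degree pieces of `Z`
  act by zero is NOT rendered (weaker, not stronger, than print).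
* "Hodge isometry" (Abstract; both `f̃` and `f̃⁻¹` are morphisms of `𝒢_an`, compositions of Hodge
  isometries): rational classes correspond to rational classes (`IsRationalClass`, an `↔`), and Hodge
  types correspond — `(p,q) ↦ (p,q)` in the degree-preserving case, `(p,q) ↦ (2n−q, 2n−p)` in the
  degree-reversing case (an algebraic class of codimension `e` on `Y × X` shifts types by
  `(e − 2n, e − 2n)`; `e = 4n − 2i`, `p + q = 2i`) — stated in both directions.
* "isometry with respect to the Mukai pairings": with the MARKING generators `P_X ∈ H^{4n}(X(ℂ))`,
  `P_Y` (clause (k1) of `IsMarkedK3Hilb`, pinned to the class of a point by the Fujiki clause (k3),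
  `∫_X P_X = 1`, docstring of `K3HilbertTypeMonodromy`), `∫_X x ∪ y` is the coefficient of `x ∪ y`
  on `P_X`; for `x ∈ H^{2i}`, `y ∈ H^{2j}`, `i + j = 2n`, `(x,y) = (−1)ⁱ ∫ x ∪ y` and
  `(f̃x, f̃y) = (−1)^{i'} ∫ f̃x ∪ f̃y` with `i' = i` or `i' = 2n − i ≡ i (mod 2)`, so the isometry reads
  `x ∪ y = t·P_X ⇒ f̃x ∪ f̃y = t·P_Y` in both cases (pairs of non-complementary degrees pair to `0` on
  both sides).
* `c₂(X)^{n−1}` in Thm. 1.1 (2): the tree's carriers have no tangent sheaf / Chern classes of `X`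
  (cf. the "Rendering" note of `K3HilbertSquareTypeCohomology`: `(6/5)q^∨ = c₂(T_X)` is not a clause
  there either), so the class `c₂(X)^{n−1}` is rendered as SOME rational algebraic class
  `κ ∈ N^{2(n−1)}H^{4(n−1)}(X(ℂ))` — which `c₂(T_X)^{n−1}` is (Chern classes of algebraic bundles are
  algebraic, Fulton Prop. 19.1.2; products of algebraic classes are algebraic, Voisin II Prop. 9.20).
  This is the ONE place where the rendering is weaker than print; recorded, not silent:
  `-- TODO(general form): κ = c₂(T_X)^{n−1} once the tangent sheaf is an object on the tree's carriers.`
* Hypotheses on `(X, Y, f)`: VERBATIM those of `Markman2024_rationalHodgeIsometry_algebraic_marked`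
  generalised from `n = 2` to `n ≥ 2` through the Beauville–Bogomolov markings `IsMarkedK3Hilb n`
  of `K3HilbertTypeMonodromy` (clauses (k1)–(k3) = (m1)–(m3); for `n = 2` the bridge is
  `isMarkedK3Hilb_two_of_clauses` of `K3HilbertSquareTypeCohomology`): `X, Y` smooth projective of
  dimension `2n` and of `K3^{[n]}`-type, `f : H²(X(ℂ); ℂ) → H²(Y(ℂ); ℂ)` a `ℂ`-linear bijection
  preserving rational classes and Hodge types and ISOMETRIC IN THE MARKINGS
  (`q(φ_Y f a, φ_Y f b) = q(φ_X a, φ_X b)`, `q = k3HilbertForm n`).  `n ≥ 2` as in the tree's other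
  `K3^{[n]}` facts (the lattice `Λ_{K3} ⊕ ⟨2 − 2n⟩` degenerates at `n = 1`; the K3 case of the LIFT is
  Buskin/Huybrechts and is not recorded here).
* Signs and scalars (read, so that the conjunction rendered is the printed one).  Proof of Thm. 1.1
  (§9, arXiv p. 35): "We may assume that `ν(f) = 1`, possibly after replacing `f` by `−f` (and `f̃` by
  `−f̃` in the statement of the theorem)" — `−f̃` is again induced by an algebraic class, with algebraic
  inverse, Mukai-isometric and Hodge, so every clause below is insensitive to this sign.  In case (1)
  the proof picks `φ ∈ 𝒢_an` with `H̃₀(φ) = f` (Thm. 9.1) and notes, by Lemma 3.6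
  (`H̃(φ)₀ = ±t^{n−1}·φ|_{H²}` when `H̃(φ)(α) = t⁻¹α`), that `f` is a rational multiple of `φ|_{H²}`; the
  renormalisation of `φ` to an `f̃` that restricts to `f` EXACTLY while staying a Mukai isometry is by
  Markman's grading operator `μ_t` (§1.3: "`μ_t` […] multiplying `H^{2k}(X,ℚ)[dim X]` by `tᵏ`", a
  Mukai isometry acting on `H²` by `t^{1−n}`), which is algebraic together with its inverse: §10.2,
  "The isomorphism `μ_t` is algebraic, since the Lefschetz standard conjecture holds for `Y`, by
  [CharlesMarkman2013], and so the Künneth factors of the diagonal […] are algebraic".  The statement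
  typed below is Thm. 1.1 as PRINTED (isometry AND, in case (1), restriction equal to `f`).

## Content

* §1 `IsDegreePreservingAlgebraicLift n μ X Y hX hY PX PY f F`, `IsDegreeReversingAlgebraicLift n hn μ
  X Y hX hY PX PY f G` — the two shapes of lift data (definitions with bodies) + projection lemmas.
* §2 the NAMED FACT `Markman2024_rationalHodgeIsometry_lift_algebraic_marked` (Thm. 1.1 + Thm. 1.4,
  projective case, marked rendering, all `n ≥ 2`).
* §3 PROVED: `corrAction_mem_algebraicClasses_of_cupProductFact` (an algebraic correspondence maps
  algebraic classes to algebraic classes, from the tree's reduction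
  `corrClassAction_mem_algebraicClasses_of_cupProduct` fed with the named fact
  `Voisin2003_cupProduct_algebraicClasses`), and the consumer's rung for every `n ≥ 2`:
  `Markman2024_rationalHodgeIsometry_lift_algebraic_marked.hodgeConjectureFor_iff` — **for marked
  projective `K3^{[n]}`-type `X, Y` with a rational Hodge isometry `H²(X,ℚ) ⥲ H²(Y,ℚ)`,
  `HodgeConjectureFor (2n) X ↔ HodgeConjectureFor (2n) Y`** (given Hodge models of `X`, `Y` and an
  orientation family with Poincaré duality) — ROUTE-P1D's row HK12 / rung R1a, labelled there
  PRINT-IMPLIED («not stated in Markman's paper»), here a theorem modulo the two named facts.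
* §4 PROVED: `….hodgeConjectureFor_iff_K3HilbertSquare` — the `n = 2` case in the literal binders of
  the route (clauses (m1)–(m3) of `MarkedK3Sq`, `IsSmoothProjective 4`, `IsOfK3HilbertSquareType`),
  through the bridge `isMarkedK3Hilb_two_of_clauses` of `K3HilbertSquareTypeCohomology`.

D-0026 accounting: two definitions with bodies, ONE new named fact (a refereed theorem in print,
cited at the page), proved lemmas; no restatement of an existing fact (the tree's two Markman facts
are the `H²`-statement; this is the total-cohomology lift they exclude by name).

## References

* [Markman2024] E. Markman, Rational Hodge isometries of hyper-Kähler varieties of `K3^{[n]}` type are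
  algebraic, Compos. Math. 160 (2024) 1261–1303, §1.1: Thm. 1.1 (pp. 1261–1262), Def. 1.2–1.3,
  Thm. 1.4 (p. 1264), Abstract; arXiv:2204.00516v2 pp. 3–5; §3.2 Lemma 3.6–3.7, §9 (proofs of
  Thm. 1.1, 1.4, 9.1), §10.2 (algebraicity of `μ_t`).
* [CharlesMarkman2013] F. Charles, E. Markman, The standard conjectures for holomorphic symplectic
  varieties deformation equivalent to Hilbert schemes of K3 surfaces, Compos. Math. 149 (2013)
  481–494 (Lefschetz standard conjecture for `K3^{[n]}`-type, used by [Markman2024, §10.2]).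
* [VoisinHodgeII2003] C. Voisin, Hodge Theory and Complex Algebraic Geometry II (2003), §9.2.4
  Prop. 9.20–9.21 (algebraic correspondences preserve algebraic classes).
* [Fulton1998] W. Fulton, Intersection Theory, 2nd ed. (1998), §19.1 Prop. 19.1.2 (Chern classes are
  algebraic), §16.1 (correspondences).
* [Beauville1983] A. Beauville, Variétés kählériennes dont la première classe de Chern est nulle,
  J. Differential Geom. 18 (1983), §8 Thm. 5, §9 (the BBF lattice of `S^{[n]}`).
-/

noncomputable section

open CategoryTheory MonoidalCategory

namespace Literature.AlgebraicGeometry.Hyperkaehler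

open Literature.AlgebraicTopology.SingularHomology

/-! ### §1 The two shapes of Markman's lift `f̃ : H^*(X,ℚ) → H^*(Y,ℚ)` on the tree's degree-wise carriers -/

section LiftData

variable (n : ℕ) (μ : HodgeTheory.OrientationFamily) (X Y : Motives.SchemeOver ℂ)
  (hX : Motives.IsSmoothProjective (2 * n) X) (hY : Motives.IsSmoothProjective (2 * n) Y)
  (PX : HodgeTheory.complexBetti X (2 * (2 * n))) (PY : HodgeTheory.complexBetti Y (2 * (2 * n)))
  (f : HodgeTheory.complexBetti X 2 →ₗ[ℂ] HodgeTheory.complexBetti Y 2)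

/-- **Degree-PRESERVING lift data** (Markman Thm. 1.1 case (1) with Thm. 1.4, projective case, read
on `H^{ev} ⊗ ℂ` degree by degree): a family `F i : H^{2i}(X(ℂ); ℂ) → H^{2i}(Y(ℂ); ℂ)` (`i ≤ 2n = dim X`)
such that (L1) each `F i` is bijective; (L2) rational classes correspond under `F i`; (L3) Hodge types
`(p,q)` correspond under `F i`; (L4) ONE algebraic class `Z ∈ N^{2n}H^{4n}((Y ⊗ X)(ℂ); ℂ)` induces
every `F i` as the correspondence `[Z]_* = pr_{Y*}(pr_X^*(–) ∪ Z)` (`HodgeTheory.corrAction μ`);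
(L5) ONE algebraic class `W ∈ N^{2n}H^{4n}((X ⊗ Y)(ℂ); ℂ)` induces a left inverse `[W]_* ∘ F i = id`
(with (L1): the inverse — `f̃⁻¹` is a morphism of the groupoid `𝒢_an`, "induced by analytic
correspondences", algebraic for projective `X, Y`); (L6) Mukai isometry: for `x ∈ H^{2i}`,
`y ∈ H^{2j}`, `i + j = 2n`, `x ∪ y = t·P_X ⇒ F x ∪ F y = t·P_Y` (`P_X, P_Y` the point classes of the
markings; the signs `(−1)ⁱ` of `α^∨` cancel); (L7) `F` restricts to `H²` as `f`.
[cite: Markman2024, §1.1 Thm. 1.1 (1) (pp. 1261–1262), Thm. 1.4 (p. 1264) and Abstract] -/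
def IsDegreePreservingAlgebraicLift
    (F : (i : ℕ) → (HodgeTheory.complexBetti X (2 * i) →ₗ[ℂ] HodgeTheory.complexBetti Y (2 * i))) :
    Prop :=
  (∀ i, i ≤ 2 * n → Function.Bijective (F i)) ∧
  (∀ i, i ≤ 2 * n → ∀ x : HodgeTheory.complexBetti X (2 * i),
      (HodgeTheory.IsRationalClass x ↔ HodgeTheory.IsRationalClass (F i x))) ∧
  (∀ i, i ≤ 2 * n → ∀ (p q : ℕ) (x : HodgeTheory.complexBetti X (2 * i)),
      (HodgeTheory.IsOfHodgeType (2 * n) X (2 * i) p q x →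
        HodgeTheory.IsOfHodgeType (2 * n) Y (2 * i) p q (F i x)) ∧
      (HodgeTheory.IsOfHodgeType (2 * n) Y (2 * i) p q (F i x) →
        HodgeTheory.IsOfHodgeType (2 * n) X (2 * i) p q x)) ∧
  (∃ Z ∈ HodgeTheory.algebraicClasses (Y ⊗ X) (2 * n), ∀ i, i ≤ 2 * n →
      ∀ x : HodgeTheory.complexBetti X (2 * i),
        F i x = HodgeTheory.corrAction μ hY hX
          (rfl : 2 * i + 2 * (2 * n) = 2 * i + 2 * (2 * n)) Z x) ∧
  (∃ W ∈ HodgeTheory.algebraicClasses (X ⊗ Y) (2 * n), ∀ i, i ≤ 2 * n →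
      ∀ x : HodgeTheory.complexBetti X (2 * i),
        HodgeTheory.corrAction μ hX hY
          (rfl : 2 * i + 2 * (2 * n) = 2 * i + 2 * (2 * n)) W (F i x) = x) ∧
  (∀ (i j : ℕ) (_hij : i + j = 2 * n) (x : HodgeTheory.complexBetti X (2 * i))
      (y : HodgeTheory.complexBetti X (2 * j)) (t : ℂ),
      cupProduct (by omega : 2 * i + 2 * j = 2 * (2 * n)) x y = t • PX →
        cupProduct (by omega : 2 * i + 2 * j = 2 * (2 * n)) (F i x) (F j y) = t • PY) ∧
  (∀ x : HodgeTheory.complexBetti X 2, F 1 x = f x)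

/-- **Degree-REVERSING lift data** (Markman Thm. 1.1 case (2) with Thm. 1.4, projective case), indexed
by the SOURCE degree: a family `G i : H^{2i}(X(ℂ); ℂ) → H^{2(2n−i)}(Y(ℂ); ℂ)` (`i ≤ 2n`) such that
(R1) each `G i` is bijective; (R2) rational classes correspond; (R3) Hodge types correspond as
`(p,q) ↔ (2n−q, 2n−p)` (an algebraic class of codimension `4n − 2i` on `Y × X` shifts types by
`2n − 2i`); (R4) for each `i` an algebraic class `Z_i ∈ N^{4n−2i}H^{8n−4i}((Y ⊗ X)(ℂ); ℂ)` (the graded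
piece of Markman's mixed class) induces `G i = [Z_i]_*`; (R5) for each `i` an algebraic
`W_i ∈ N^{2i}H^{4i}((X ⊗ Y)(ℂ); ℂ)` induces a left inverse `[W_i]_* ∘ G i = id` (`f̃⁻¹ ∈ 𝒢_an` is
again degree reversing and induced by an algebraic class); (R6) Mukai isometry
`x ∪ y = t·P_X ⇒ G x ∪ G y = t·P_Y` for `x ∈ H^{2i}`, `y ∈ H^{2j}`, `i + j = 2n` (here
`(−1)^{2n−i} = (−1)ⁱ`); (R7) "`f̃ ∘ (c₂(X)^{n−1} ∪ –)` restricts to `H²` as a non-zero rational multiple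
`t` of `f`": with `c₂(X)^{n−1}` rendered as SOME rational algebraic class `κ` of codimension `2(n−1)`
(the tree has no tangent-sheaf Chern classes on its carriers; see the module docstring),
`G_{2n−1}(κ ∪ x) = t · f x` — the degree `2(2n − (2n−1)) = 2` being transported by
`HodgeTheory.complexBetti.degCast` (identity).  Requires `1 ≤ n` for the degree bookkeeping.
-- TODO(general form): `κ = c₂(T_X)^{n−1}` once the tangent sheaf of `X` is an object on the carriers.
[cite: Markman2024, §1.1 Thm. 1.1 (2) (pp. 1261–1262), Thm. 1.4 (p. 1264) and Abstract]
[cite: Fulton1998, §19.1 Prop. 19.1.2] -/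
def IsDegreeReversingAlgebraicLift (hn : 1 ≤ n)
    (G : (i : ℕ) →
      (HodgeTheory.complexBetti X (2 * i) →ₗ[ℂ] HodgeTheory.complexBetti Y (2 * (2 * n - i)))) :
    Prop :=
  (∀ i, i ≤ 2 * n → Function.Bijective (G i)) ∧
  (∀ i, i ≤ 2 * n → ∀ x : HodgeTheory.complexBetti X (2 * i),
      (HodgeTheory.IsRationalClass x ↔ HodgeTheory.IsRationalClass (G i x))) ∧
  (∀ i, i ≤ 2 * n → ∀ (p q : ℕ) (x : HodgeTheory.complexBetti X (2 * i)),
      (HodgeTheory.IsOfHodgeType (2 * n) X (2 * i) p q x →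
        HodgeTheory.IsOfHodgeType (2 * n) Y (2 * (2 * n - i)) (2 * n - q) (2 * n - p) (G i x)) ∧
      (HodgeTheory.IsOfHodgeType (2 * n) Y (2 * (2 * n - i)) p q (G i x) →
        HodgeTheory.IsOfHodgeType (2 * n) X (2 * i) (2 * n - q) (2 * n - p) x)) ∧
  (∀ (i : ℕ) (_hi : i ≤ 2 * n), ∃ Z ∈ HodgeTheory.algebraicClasses (Y ⊗ X) (2 * (2 * n - i)),
      ∀ x : HodgeTheory.complexBetti X (2 * i),
        G i x = HodgeTheory.corrAction μ hY hX
          (by omega : 2 * i + 2 * (2 * (2 * n - i)) = 2 * (2 * n - i) + 2 * (2 * n)) Z x) ∧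
  (∀ (i : ℕ) (_hi : i ≤ 2 * n), ∃ W ∈ HodgeTheory.algebraicClasses (X ⊗ Y) (2 * i),
      ∀ x : HodgeTheory.complexBetti X (2 * i),
        HodgeTheory.corrAction μ hX hY
          (by omega : 2 * (2 * n - i) + 2 * (2 * i) = 2 * i + 2 * (2 * n)) W (G i x) = x) ∧
  (∀ (i j : ℕ) (_hij : i + j = 2 * n) (x : HodgeTheory.complexBetti X (2 * i))
      (y : HodgeTheory.complexBetti X (2 * j)) (t : ℂ),
      cupProduct (by omega : 2 * i + 2 * j = 2 * (2 * n)) x y = t • PX →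
        cupProduct (by omega : 2 * (2 * n - i) + 2 * (2 * n - j) = 2 * (2 * n)) (G i x) (G j y) =
          t • PY) ∧
  (∃ κ ∈ HodgeTheory.algebraicClasses X (2 * (n - 1)), HodgeTheory.IsRationalClass κ ∧
    ∃ t : ℚ, t ≠ 0 ∧ ∀ x : HodgeTheory.complexBetti X 2,
      HodgeTheory.complexBetti.degCast Y (by omega : 2 * (2 * n - (2 * n - 1)) = 2)
        (G (2 * n - 1) (cupProduct (by omega : 2 * (2 * (n - 1)) + 2 = 2 * (2 * n - 1)) κ x)) =
        (t : ℂ) • f x)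

end LiftData

/-! #### Projections of the lift data (proved; for consumers) -/

namespace IsDegreePreservingAlgebraicLift

variable {n : ℕ} {μ : HodgeTheory.OrientationFamily} {X Y : Motives.SchemeOver ℂ}
  {hX : Motives.IsSmoothProjective (2 * n) X} {hY : Motives.IsSmoothProjective (2 * n) Y}
  {PX : HodgeTheory.complexBetti X (2 * (2 * n))} {PY : HodgeTheory.complexBetti Y (2 * (2 * n))}
  {f : HodgeTheory.complexBetti X 2 →ₗ[ℂ] HodgeTheory.complexBetti Y 2}
  {F : (i : ℕ) → (HodgeTheory.complexBetti X (2 * i) →ₗ[ℂ] HodgeTheory.complexBetti Y (2 * i))}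
  (h : IsDegreePreservingAlgebraicLift n μ X Y hX hY PX PY f F)
include h

/-- (L1) each `F i` is bijective. [cite: Markman2024, §1.1 Thm. 1.1 and Thm. 1.4] -/
theorem bijective {i : ℕ} (hi : i ≤ 2 * n) : Function.Bijective (F i) :=
  h.1 i hi

/-- (L2) rational classes correspond. [cite: Markman2024, §1.1 Thm. 1.1 and Abstract] -/
theorem isRationalClass_iff {i : ℕ} (hi : i ≤ 2 * n) (x : HodgeTheory.complexBetti X (2 * i)) :
    HodgeTheory.IsRationalClass x ↔ HodgeTheory.IsRationalClass (F i x) :=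
  h.2.1 i hi x

/-- (L3) Hodge types are preserved. [cite: Markman2024, §1.1 Thm. 1.1 and Abstract] -/
theorem isOfHodgeType_map {i : ℕ} (hi : i ≤ 2 * n) {p q : ℕ}
    {x : HodgeTheory.complexBetti X (2 * i)} (hx : HodgeTheory.IsOfHodgeType (2 * n) X (2 * i) p q x) :
    HodgeTheory.IsOfHodgeType (2 * n) Y (2 * i) p q (F i x) :=
  (h.2.2.1 i hi p q x).1 hx

/-- (L3) Hodge types are reflected. [cite: Markman2024, §1.1 Thm. 1.1 and Abstract] -/
theorem isOfHodgeType_of_map {i : ℕ} (hi : i ≤ 2 * n) {p q : ℕ}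
    {x : HodgeTheory.complexBetti X (2 * i)}
    (hx : HodgeTheory.IsOfHodgeType (2 * n) Y (2 * i) p q (F i x)) :
    HodgeTheory.IsOfHodgeType (2 * n) X (2 * i) p q x :=
  (h.2.2.1 i hi p q x).2 hx

/-- (L4) `F = [Z]_*` for one algebraic `Z` on `Y × X`. [cite: Markman2024, §1.1 Thm. 1.1 and Abstract] -/
theorem exists_eq_corrAction :
    ∃ Z ∈ HodgeTheory.algebraicClasses (Y ⊗ X) (2 * n), ∀ i, i ≤ 2 * n →
      ∀ x : HodgeTheory.complexBetti X (2 * i),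
        F i x = HodgeTheory.corrAction μ hY hX
          (rfl : 2 * i + 2 * (2 * n) = 2 * i + 2 * (2 * n)) Z x :=
  h.2.2.2.1

/-- (L5) an algebraic left inverse `[W]_* ∘ F = id`. [cite: Markman2024, §1.1 Thm. 1.4 (p. 1264)] -/
theorem exists_corrAction_leftInverse :
    ∃ W ∈ HodgeTheory.algebraicClasses (X ⊗ Y) (2 * n), ∀ i, i ≤ 2 * n →
      ∀ x : HodgeTheory.complexBetti X (2 * i),
        HodgeTheory.corrAction μ hX hY
          (rfl : 2 * i + 2 * (2 * n) = 2 * i + 2 * (2 * n)) W (F i x) = x :=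
  h.2.2.2.2.1

/-- (L6) Mukai isometry, degree-wise. [cite: Markman2024, §1.1 Thm. 1.1] -/
theorem cupProduct_eq {i j : ℕ} (hij : i + j = 2 * n) (x : HodgeTheory.complexBetti X (2 * i))
    (y : HodgeTheory.complexBetti X (2 * j)) (t : ℂ)
    (hxy : cupProduct (by omega : 2 * i + 2 * j = 2 * (2 * n)) x y = t • PX) :
    cupProduct (by omega : 2 * i + 2 * j = 2 * (2 * n)) (F i x) (F j y) = t • PY :=
  h.2.2.2.2.2.1 i j hij x y t hxy

/-- (L7) `F` restricts to `H²` as `f`. [cite: Markman2024, §1.1 Thm. 1.1 (1)] -/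
theorem apply_one (x : HodgeTheory.complexBetti X 2) : F 1 x = f x :=
  h.2.2.2.2.2.2 x

end IsDegreePreservingAlgebraicLift

namespace IsDegreeReversingAlgebraicLift

variable {n : ℕ} {hn : 1 ≤ n} {μ : HodgeTheory.OrientationFamily} {X Y : Motives.SchemeOver ℂ}
  {hX : Motives.IsSmoothProjective (2 * n) X} {hY : Motives.IsSmoothProjective (2 * n) Y}
  {PX : HodgeTheory.complexBetti X (2 * (2 * n))} {PY : HodgeTheory.complexBetti Y (2 * (2 * n))}
  {f : HodgeTheory.complexBetti X 2 →ₗ[ℂ] HodgeTheory.complexBetti Y 2}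
  {G : (i : ℕ) →
    (HodgeTheory.complexBetti X (2 * i) →ₗ[ℂ] HodgeTheory.complexBetti Y (2 * (2 * n - i)))}
  (h : IsDegreeReversingAlgebraicLift n μ X Y hX hY PX PY f hn G)
include h

/-- (R1) each `G i` is bijective. [cite: Markman2024, §1.1 Thm. 1.1 and Thm. 1.4] -/
theorem bijective {i : ℕ} (hi : i ≤ 2 * n) : Function.Bijective (G i) :=
  h.1 i hi

/-- (R2) rational classes correspond. [cite: Markman2024, §1.1 Thm. 1.1 and Abstract] -/
theorem isRationalClass_iff {i : ℕ} (hi : i ≤ 2 * n) (x : HodgeTheory.complexBetti X (2 * i)) :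
    HodgeTheory.IsRationalClass x ↔ HodgeTheory.IsRationalClass (G i x) :=
  h.2.1 i hi x

/-- (R3) Hodge types `(p,q) ↦ (2n−q, 2n−p)`. [cite: Markman2024, §1.1 Thm. 1.1 and Abstract] -/
theorem isOfHodgeType_map {i : ℕ} (hi : i ≤ 2 * n) {p q : ℕ}
    {x : HodgeTheory.complexBetti X (2 * i)} (hx : HodgeTheory.IsOfHodgeType (2 * n) X (2 * i) p q x) :
    HodgeTheory.IsOfHodgeType (2 * n) Y (2 * (2 * n - i)) (2 * n - q) (2 * n - p) (G i x) :=
  (h.2.2.1 i hi p q x).1 hx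

/-- (R3) Hodge types reflected, `(p,q) ↦ (2n−q, 2n−p)`. [cite: Markman2024, §1.1 Thm. 1.1 and Abstract] -/
theorem isOfHodgeType_of_map {i : ℕ} (hi : i ≤ 2 * n) {p q : ℕ}
    {x : HodgeTheory.complexBetti X (2 * i)}
    (hx : HodgeTheory.IsOfHodgeType (2 * n) Y (2 * (2 * n - i)) p q (G i x)) :
    HodgeTheory.IsOfHodgeType (2 * n) X (2 * i) (2 * n - q) (2 * n - p) x :=
  (h.2.2.1 i hi p q x).2 hx

/-- (R4) `G i = [Z_i]_*` for an algebraic `Z_i` on `Y × X`. [cite: Markman2024, §1.1 Thm. 1.1 and Abstract] -/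
theorem exists_eq_corrAction {i : ℕ} (hi : i ≤ 2 * n) :
    ∃ Z ∈ HodgeTheory.algebraicClasses (Y ⊗ X) (2 * (2 * n - i)),
      ∀ x : HodgeTheory.complexBetti X (2 * i),
        G i x = HodgeTheory.corrAction μ hY hX
          (by omega : 2 * i + 2 * (2 * (2 * n - i)) = 2 * (2 * n - i) + 2 * (2 * n)) Z x :=
  h.2.2.2.1 i hi

/-- (R5) an algebraic left inverse `[W_i]_* ∘ G i = id`. [cite: Markman2024, §1.1 Thm. 1.4 (p. 1264)] -/
theorem exists_corrAction_leftInverse {i : ℕ} (hi : i ≤ 2 * n) :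
    ∃ W ∈ HodgeTheory.algebraicClasses (X ⊗ Y) (2 * i),
      ∀ x : HodgeTheory.complexBetti X (2 * i),
        HodgeTheory.corrAction μ hX hY
          (by omega : 2 * (2 * n - i) + 2 * (2 * i) = 2 * i + 2 * (2 * n)) W (G i x) = x :=
  h.2.2.2.2.1 i hi

/-- (R6) Mukai isometry, degree-wise. [cite: Markman2024, §1.1 Thm. 1.1] -/
theorem cupProduct_eq {i j : ℕ} (hij : i + j = 2 * n) (x : HodgeTheory.complexBetti X (2 * i))
    (y : HodgeTheory.complexBetti X (2 * j)) (t : ℂ)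
    (hxy : cupProduct (by omega : 2 * i + 2 * j = 2 * (2 * n)) x y = t • PX) :
    cupProduct (by omega : 2 * (2 * n - i) + 2 * (2 * n - j) = 2 * (2 * n)) (G i x) (G j y) =
      t • PY :=
  h.2.2.2.2.2.1 i j hij x y t hxy

/-- (R7) `f̃ ∘ (κ ∪ –)` restricts to `H²` as `t · f`, `t ∈ ℚˣ`, for a rational algebraic `κ` of
codimension `2(n−1)` (print: `κ = c₂(X)^{n−1}`). [cite: Markman2024, §1.1 Thm. 1.1 (2)] -/
theorem exists_restrict_two :
    ∃ κ ∈ HodgeTheory.algebraicClasses X (2 * (n - 1)), HodgeTheory.IsRationalClass κ ∧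
      ∃ t : ℚ, t ≠ 0 ∧ ∀ x : HodgeTheory.complexBetti X 2,
        HodgeTheory.complexBetti.degCast Y (by omega : 2 * (2 * n - (2 * n - 1)) = 2)
          (G (2 * n - 1) (cupProduct (by omega : 2 * (2 * (n - 1)) + 2 = 2 * (2 * n - 1)) κ x)) =
          (t : ℂ) • f x :=
  h.2.2.2.2.2.2

end IsDegreeReversingAlgebraicLift

/-! ### §2 The named fact -/

/-- **Markman, Compos. Math. 2024, Thm. 1.1 (the LIFT `f̃`) with Thm. 1.4 (`f̃ ∈ 𝒢_an`), projective case,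
marked rendering, every `n ≥ 2`.**  Let `X, Y` be smooth projective of dimension `2n` and of
`K3^{[n]}`-type, with Beauville–Bogomolov markings `(φ_X, P_X)`, `(φ_Y, P_Y)` (`IsMarkedK3Hilb n`), and
let `f : H²(X(ℂ); ℂ) → H²(Y(ℂ); ℂ)` be a `ℂ`-linear bijection preserving rational classes and Hodge
types and isometric in the markings (`q(φ_Y f a, φ_Y f b) = q(φ_X a, φ_X b)`, `q = k3HilbertForm n`,
the BBF pairings) — a rational Hodge isometry.  THEN, for every orientation family `μ` with Poincaré
duality, EITHER there is degree-preserving lift data `F` (`IsDegreePreservingAlgebraicLift`: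
`F i : H^{2i}(X) ⥲ H^{2i}(Y)` bijective, rational and Hodge both ways, `F = [Z]_*` and
`[W]_* ∘ F = id` for algebraic `Z` on `Y × X`, `W` on `X × Y`, Mukai-isometric, `F|_{H²} = f`), OR
there is degree-reversing lift data `G` (`IsDegreeReversingAlgebraicLift`: `G i : H^{2i}(X) ⥲
H^{2(2n−i)}(Y)`, same clauses with Hodge types `(p,q) ↦ (2n−q,2n−p)`, and `G(κ ∪ x) = t·f x` on `H²`
for a rational algebraic `κ` of codimension `2(n−1)` — print: `κ = c₂(X)^{n−1}` — and `t ∈ ℚˣ`).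
Verbatim: "There exists an analytic correspondence `f̃ : H^*(X,ℚ) → H^*(Y,ℚ)`, which is an isometry
with respect to the Mukai pairings and satisfies one of the following: (1) `f̃` is degree preserving
and it restricts to `H²(X,ℚ)` as `f`; (2) `f̃` is degree reversing and the composition […] with cup
product with `c₂(X)^{n−1}` restricts to `H²(X,ℚ)` as a non-zero rational multiple of `f`." /
"the analytic correspondence `f̃` of Theorem 1.1 can be chosen to be a morphism in
`Hom_{𝒢_an^{[n]}}((X,ε),(Y,ε'))`" / "Morphisms in `𝒢_an` are induced by analytic correspondences" /
"When `X` and `Y` are projective the correspondences `f` and `F` are algebraic."  The `H²`-statement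
alone is `Markman2024_rationalHodgeIsometry_algebraic(_marked)`.
[cite: Markman2024, §1.1 Thm. 1.1 (pp. 1261–1262), Thm. 1.4 (p. 1264), p. 1264 (morphisms of 𝒢_an) and Abstract]
[cite: Beauville1983, §8 Thm. 5 and §9 Rem. 1] -/
def Markman2024_rationalHodgeIsometry_lift_algebraic_marked : Prop :=
  ∀ (n : ℕ) (hn : 2 ≤ n) (μ : HodgeTheory.OrientationFamily), μ.HasPoincareDuality →
    ∀ (X Y : Motives.SchemeOver ℂ) (hX : Motives.IsSmoothProjective (2 * n) X)
      (hY : Motives.IsSmoothProjective (2 * n) Y),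
      IsOfK3HilbertType n X → IsOfK3HilbertType n Y →
      ∀ (φX : HodgeTheory.complexBetti X 2 ≃ₗ[ℂ] (K3HilbertIndex → ℂ))
        (PX : HodgeTheory.complexBetti X (2 * (2 * n)))
        (φY : HodgeTheory.complexBetti Y 2 ≃ₗ[ℂ] (K3HilbertIndex → ℂ))
        (PY : HodgeTheory.complexBetti Y (2 * (2 * n))),
        IsMarkedK3Hilb n X φX PX → IsMarkedK3Hilb n Y φY PY →
        ∀ (f : HodgeTheory.complexBetti X 2 →ₗ[ℂ] HodgeTheory.complexBetti Y 2),
          Function.Bijective f →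
          (∀ x, HodgeTheory.IsRationalClass x → HodgeTheory.IsRationalClass (f x)) →
          (∀ (i j : ℕ) x, HodgeTheory.IsOfHodgeType (2 * n) X 2 i j x →
            HodgeTheory.IsOfHodgeType (2 * n) Y 2 i j (f x)) →
          (∀ a b, k3HilbertForm n (φY (f a)) (φY (f b)) = k3HilbertForm n (φX a) (φX b)) →
          (∃ F, IsDegreePreservingAlgebraicLift n μ X Y hX hY PX PY f F) ∨
            (∃ G, IsDegreeReversingAlgebraicLift n μ X Y hX hY PX PY f (by omega) G)

/-! ### §3 Proved: algebraic correspondences preserve algebraic classes; HC is a rational-Hodge-isometry invariant -/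

/-- **An algebraic correspondence maps algebraic classes to algebraic classes** (Voisin II
Prop. 9.21 for `[γ]_* = pr_{W*}(pr_X^*(–) ∪ γ)`), for the constructed action `HodgeTheory.corrAction μ`
of an orientation family with Poincaré duality: the tree's reduction
`HodgeTheory.corrClassAction_mem_algebraicClasses_of_cupProduct` (flat pull-back, product, proper
push-forward on the coniveau carrier) fed with the named fact
`HodgeTheory.Voisin2003_cupProduct_algebraicClasses` (Prop. 9.20, multiplicativity of algebraic
classes) on `W ⊗ X`, through `corrAction_eq_corrClassAction`; target codimension `q ≤ dim W`.
[cite: VoisinHodgeII2003, §9.2.4 Prop. 9.20 and Prop. 9.21] -/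
theorem corrAction_mem_algebraicClasses_of_cupProductFact
    (hcup : HodgeTheory.Voisin2003_cupProduct_algebraicClasses)
    {μ : HodgeTheory.OrientationFamily} (hμ : μ.HasPoincareDuality) {m d : ℕ}
    {W X : Motives.SchemeOver ℂ} (hW : Motives.IsSmoothProjective m W)
    (hX : Motives.IsSmoothProjective d X) {e p q : ℕ} (hab : 2 * p + 2 * e = 2 * q + 2 * d)
    (hq : q ≤ m) {γ : HodgeTheory.complexBetti (W ⊗ X) (2 * e)}
    (hγ : γ ∈ HodgeTheory.algebraicClasses (W ⊗ X) e) {c : HodgeTheory.complexBetti X (2 * p)}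
    (hc : c ∈ HodgeTheory.algebraicClasses X p) :
    HodgeTheory.corrAction μ hW hX hab γ c ∈ HodgeTheory.algebraicClasses W q := by
  rw [HodgeTheory.corrAction_eq_corrClassAction μ hW hX hab
    (show 2 * q + (2 * m - 2 * q) = 2 * m by omega)]
  exact HodgeTheory.corrClassAction_mem_algebraicClasses_of_cupProduct hW hX _ _ (hμ hW) hab _
    (fun x y hx hy => hcup (Motives.IsSmoothProjective.tensor_holds hW hX) hx hy) hγ hc

/-- **ROUTE-P1D row HK12 / rung R1a for every `n ≥ 2` — the Hodge conjecture is an invariant of the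
rational Hodge-isometry class of `H²` among marked projective `K3^{[n]}`-type manifolds** (PROVED
modulo the named facts `Markman2024_rationalHodgeIsometry_lift_algebraic_marked` and
`HodgeTheory.Voisin2003_cupProduct_algebraicClasses`; the planner's memo labels the statement
PRINT-IMPLIED, «not stated in Markman's paper»).  Proof: a rational `(p,p)`-class `c` on `X`
(`p ≤ 2n`; above the dimension `H^{2p} = 0`) goes under `F p` (resp. `G p`) to a rational class of type
`(p,p)` (resp. `(2n−p, 2n−p)`) on `Y`, algebraic by `HC(Y)`; then `c = [W]_*(F p c)` is the image of
an algebraic class under an algebraic correspondence, hence algebraic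
(`corrAction_mem_algebraicClasses_of_cupProductFact`).  Conversely with `F p` surjective, the
reflected rationality/Hodge clauses, `HC(X)` and `F = [Z]_*`.  Hodge models of `X` and `Y` are taken as
data (the existence conjunct of `HodgeConjectureFor`), as is an orientation family with Poincaré
duality. [cite: Markman2024, §1.1 Thm. 1.1, Thm. 1.4 and Abstract]
[cite: VoisinHodgeII2003, §9.2.4 Prop. 9.21] -/
theorem Markman2024_rationalHodgeIsometry_lift_algebraic_marked.hodgeConjectureFor_iff
    (h : Markman2024_rationalHodgeIsometry_lift_algebraic_marked)
    (hcup : HodgeTheory.Voisin2003_cupProduct_algebraicClasses)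
    {n : ℕ} (hn : 2 ≤ n) {μ : HodgeTheory.OrientationFamily} (hμ : μ.HasPoincareDuality)
    {X Y : Motives.SchemeOver ℂ} (hX : Motives.IsSmoothProjective (2 * n) X)
    (hY : Motives.IsSmoothProjective (2 * n) Y) (hXt : IsOfK3HilbertType n X)
    (hYt : IsOfK3HilbertType n Y) {φX : HodgeTheory.complexBetti X 2 ≃ₗ[ℂ] (K3HilbertIndex → ℂ)}
    {PX : HodgeTheory.complexBetti X (2 * (2 * n))}
    {φY : HodgeTheory.complexBetti Y 2 ≃ₗ[ℂ] (K3HilbertIndex → ℂ)}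
    {PY : HodgeTheory.complexBetti Y (2 * (2 * n))} (hmX : IsMarkedK3Hilb n X φX PX)
    (hmY : IsMarkedK3Hilb n Y φY PY) {f : HodgeTheory.complexBetti X 2 →ₗ[ℂ] HodgeTheory.complexBetti Y 2}
    (hf : Function.Bijective f)
    (hfr : ∀ x, HodgeTheory.IsRationalClass x → HodgeTheory.IsRationalClass (f x))
    (hfh : ∀ (i j : ℕ) x, HodgeTheory.IsOfHodgeType (2 * n) X 2 i j x →
      HodgeTheory.IsOfHodgeType (2 * n) Y 2 i j (f x))
    (hfq : ∀ a b, k3HilbertForm n (φY (f a)) (φY (f b)) = k3HilbertForm n (φX a) (φX b))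
    (AX : HodgeTheory.HodgeModel (2 * n) X) (AY : HodgeTheory.HodgeModel (2 * n) Y) :
    HodgeTheory.HodgeConjectureFor (2 * n) X ↔ HodgeTheory.HodgeConjectureFor (2 * n) Y := by
  have hWX := fun {e p q : ℕ} (hab : 2 * p + 2 * e = 2 * q + 2 * (2 * n)) (hq : q ≤ 2 * n)
      {γ : HodgeTheory.complexBetti (X ⊗ Y) (2 * e)} (hγ : γ ∈ HodgeTheory.algebraicClasses (X ⊗ Y) e)
      {c : HodgeTheory.complexBetti Y (2 * p)} (hc : c ∈ HodgeTheory.algebraicClasses Y p) =>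
    corrAction_mem_algebraicClasses_of_cupProductFact hcup hμ hX hY hab hq hγ hc
  have hYX := fun {e p q : ℕ} (hab : 2 * p + 2 * e = 2 * q + 2 * (2 * n)) (hq : q ≤ 2 * n)
      {γ : HodgeTheory.complexBetti (Y ⊗ X) (2 * e)} (hγ : γ ∈ HodgeTheory.algebraicClasses (Y ⊗ X) e)
      {c : HodgeTheory.complexBetti X (2 * p)} (hc : c ∈ HodgeTheory.algebraicClasses X p) =>
    corrAction_mem_algebraicClasses_of_cupProductFact hcup hμ hY hX hab hq hγ hc
  obtain hlift := h n hn μ hμ X Y hX hY hXt hYt φX PX φY PY hmX hmY f hf hfr hfh hfq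
  constructor
  · -- `HC(X) ⇒ HC(Y)`
    intro hHX
    refine ⟨⟨AY⟩, fun p c hcr hch => ?_⟩
    by_cases hp : p ≤ 2 * n
    · rcases hlift with ⟨F, hF⟩ | ⟨G, hG⟩
      · obtain ⟨x, rfl⟩ := (hF.bijective hp).2 c
        obtain ⟨Z, hZ, hFZ⟩ := hF.exists_eq_corrAction
        have hx : x ∈ HodgeTheory.algebraicClasses X p :=
          hHX.2 p x ((hF.isRationalClass_iff hp x).2 hcr) (hF.isOfHodgeType_of_map hp hch)
        rw [hFZ p hp x]
        exact hYX rfl hp hZ hx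
      · -- write `p = 2n - i`, so that `c` lies in the target of `G i`
        obtain ⟨i, hi, rfl⟩ : ∃ i, i ≤ 2 * n ∧ p = 2 * n - i := ⟨2 * n - p, by omega, by omega⟩
        obtain ⟨x, rfl⟩ := (hG.bijective hi).2 c
        obtain ⟨Z, hZ, hGZ⟩ := hG.exists_eq_corrAction hi
        have hxh : HodgeTheory.IsOfHodgeType (2 * n) X (2 * i) i i x := by
          have := hG.isOfHodgeType_of_map hi hch
          rwa [show 2 * n - (2 * n - i) = i from by omega] at this
        have hx : x ∈ HodgeTheory.algebraicClasses X i :=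
          hHX.2 i x ((hG.isRationalClass_iff hi x).2 hcr) hxh
        rw [hGZ x]
        exact hYX _ (by omega) hZ hx
    · haveI := HodgeTheory.subsingleton_complexBetti hY (k := 2 * p) (by omega)
      rw [Subsingleton.elim c 0]
      exact Submodule.zero_mem _
  · -- `HC(Y) ⇒ HC(X)`
    intro hHY
    refine ⟨⟨AX⟩, fun p c hcr hch => ?_⟩
    by_cases hp : p ≤ 2 * n
    · rcases hlift with ⟨F, hF⟩ | ⟨G, hG⟩
      · obtain ⟨W, hW, hWF⟩ := hF.exists_corrAction_leftInverse
        have hy : F p c ∈ HodgeTheory.algebraicClasses Y p :=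
          hHY.2 p (F p c) ((hF.isRationalClass_iff hp c).1 hcr) (hF.isOfHodgeType_map hp hch)
        rw [← hWF p hp c]
        exact hWX rfl hp hW hy
      · obtain ⟨W, hW, hWG⟩ := hG.exists_corrAction_leftInverse hp
        have hy : G p c ∈ HodgeTheory.algebraicClasses Y (2 * n - p) :=
          hHY.2 (2 * n - p) (G p c) ((hG.isRationalClass_iff hp c).1 hcr)
            (hG.isOfHodgeType_map hp hch)
        rw [← hWG c]
        exact hWX _ hp hW hy
    · haveI := HodgeTheory.subsingleton_complexBetti hX (k := 2 * p) (by omega)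
      rw [Subsingleton.elim c 0]
      exact Submodule.zero_mem _

/-! ### §4 The `K3^{[2]}` case in the binder shape of the route (`MarkedK3Sq` clauses (m1)–(m3)) -/

/-- **R1a for `K3^{[2]}`-type fourfolds, literally in the binders of the route's
`HC_K3Sq2Type_isometryInvariant` / `Markman2024_rationalHodgeIsometry_algebraic_marked`** (clauses
(m1)–(m3) of `MarkedK3Sq[X, φ, P, z]` — the period clauses (m4)–(m6) are not needed): for smooth
projective fourfolds `X, Y` of `K3^{[2]}`-type with such markings and a rational Hodge isometry
`f : H²(X(ℂ); ℂ) → H²(Y(ℂ); ℂ)` in the marked sense, `HodgeConjectureFor 4 X ↔ HodgeConjectureFor 4 Y`,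
modulo the named facts `Markman2024_rationalHodgeIsometry_lift_algebraic_marked` and
`HodgeTheory.Voisin2003_cupProduct_algebraicClasses`, given Hodge models and an orientation family with
Poincaré duality.  The bridge (m1)–(m3) ⇒ `IsMarkedK3Hilb 2` is `isMarkedK3Hilb_two_of_clauses`
(`K3HilbertSquareTypeCohomology`, Fujiki constant `3 = (2·2−1)!!`).
[cite: Markman2024, §1.1 Thm. 1.1, Thm. 1.4 and Abstract]
[cite: Rapagnetta2007, Introduction (table: Fujiki constant 3 for K3^[2])] -/
theorem Markman2024_rationalHodgeIsometry_lift_algebraic_marked.hodgeConjectureFor_iff_K3HilbertSquare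
    (h : Markman2024_rationalHodgeIsometry_lift_algebraic_marked)
    (hcup : HodgeTheory.Voisin2003_cupProduct_algebraicClasses)
    {μ : HodgeTheory.OrientationFamily} (hμ : μ.HasPoincareDuality)
    {X Y : Motives.SchemeOver ℂ} (hX : Motives.IsSmoothProjective 4 X)
    (hY : Motives.IsSmoothProjective 4 Y) (hXt : IsOfK3HilbertSquareType X)
    (hYt : IsOfK3HilbertSquareType Y)
    {φX : HodgeTheory.complexBetti X 2 ≃ₗ[ℂ] (K3HilbertIndex → ℂ)} {PX : HodgeTheory.complexBetti X (2 * 4)}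
    {φY : HodgeTheory.complexBetti Y 2 ≃ₗ[ℂ] (K3HilbertIndex → ℂ)} {PY : HodgeTheory.complexBetti Y (2 * 4)}
    (h1X : HodgeTheory.IsIntegralClass PX ∧
      ∀ Q : HodgeTheory.complexBetti X (2 * 4), HodgeTheory.IsIntegralClass Q → ∃ n : ℤ, Q = n • PX)
    (h2X : ∀ c : HodgeTheory.complexBetti X 2,
      HodgeTheory.IsIntegralClass c ↔ ∃ v : K3HilbertIndex → ℤ, φX c = fun i => (v i : ℂ))
    (h3X : ∀ a : HodgeTheory.complexBetti X 2,
      HodgeTheory.cupPowTwo a 4 = ((3 : ℂ) * (k3HilbertForm 2 (φX a) (φX a)) ^ 2) • PX)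
    (h1Y : HodgeTheory.IsIntegralClass PY ∧
      ∀ Q : HodgeTheory.complexBetti Y (2 * 4), HodgeTheory.IsIntegralClass Q → ∃ n : ℤ, Q = n • PY)
    (h2Y : ∀ c : HodgeTheory.complexBetti Y 2,
      HodgeTheory.IsIntegralClass c ↔ ∃ v : K3HilbertIndex → ℤ, φY c = fun i => (v i : ℂ))
    (h3Y : ∀ a : HodgeTheory.complexBetti Y 2,
      HodgeTheory.cupPowTwo a 4 = ((3 : ℂ) * (k3HilbertForm 2 (φY a) (φY a)) ^ 2) • PY)
    {f : HodgeTheory.complexBetti X 2 →ₗ[ℂ] HodgeTheory.complexBetti Y 2} (hf : Function.Bijective f)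
    (hfr : ∀ x, HodgeTheory.IsRationalClass x → HodgeTheory.IsRationalClass (f x))
    (hfh : ∀ (i j : ℕ) x, HodgeTheory.IsOfHodgeType 4 X 2 i j x →
      HodgeTheory.IsOfHodgeType 4 Y 2 i j (f x))
    (hfq : ∀ a b, k3HilbertForm 2 (φY (f a)) (φY (f b)) = k3HilbertForm 2 (φX a) (φX b))
    (AX : HodgeTheory.HodgeModel 4 X) (AY : HodgeTheory.HodgeModel 4 Y) :
    HodgeTheory.HodgeConjectureFor 4 X ↔ HodgeTheory.HodgeConjectureFor 4 Y :=
  h.hodgeConjectureFor_iff hcup (n := 2) le_rfl hμ hX hY hXt hYt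
    (isMarkedK3Hilb_two_of_clauses h1X h2X h3X) (isMarkedK3Hilb_two_of_clauses h1Y h2Y h3Y)
    hf hfr hfh hfq AX AY

end Literature.AlgebraicGeometry.Hyperkaehler

end
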